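import Summits.PneNP.PneNP.Theorems.ConvexRankGatesCliqueExtLowerBoundCocliqueFree

/-!
# The Tutte and Edmonds matching gates satisfy the leaf `stub_grankCnf`
(sub-class of the leaf `stub_grankCnf`, line `width-threshold-certificate-sparsity`, crux `CliqueExtLowerBound`,
stmt-PneNP-10682; stub-worker of lead c10 — extract 2/2 of `work/stubs/StubGRankCnf.lean`; imports extract 1/2
`…CocliqueFree` (`pair_of_acceptsCocliqueFree`, `exists_wireMatching`, `rank_symbolicMatrix_le_card`,
`edmonds_rank_ge`), same namespace)

The GRANK gates named in the definition of the class (`IsGRankGate`: Edmonds 1967 / Tutte 1947) — `K₀ = 0`, `d = m`,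
skew data `K_j = E_{a j, b j} − E_{b j, a j}` (TUTTE) resp. rank-ONE data `K_j = E_{a j, b j}` (EDMONDS, the
transversal / bipartite-matching class), over ANY field, with ANY threshold `θ`, any wiring `j ↦ {a j, b j}` onto the
edge slots and raw single-slot children — satisfy the conclusion of `stub_grankCnf` for every `c`, eventually in `m`
(`tutteGate_grankCnf`, `edmondsGate_grankCnf`; `…_isGRankGate`). Proof (`wireGate_grankCnf_of_matching`, for any
rank-like `ρ` witnessed by matchings and supported on the touched vertices): if `2θ + c + 19 ≤ m + 2` the gate accepts
every graph without a coclique on `c + 19` vertices (`exists_wireMatching`; `tutte_rank_ge`: the numeric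
specialisation at a `t`-matching has the invertible `2t × 2t` minor `[[0, 1], [−1, 0]]`, so rank `≥ 2t`;
`edmonds_rank_ge`: rank `≥ t`), hence is NEG-BLIND at the sharp threshold by `pair_of_acceptsCocliqueFree`; otherwise
`θ > ⌈m^{1/4}⌉₊` (`two_mul_ceil_add_le`) while a bare clique `Q` has rank `≤ #Q` (`rank_symbolicMatrix_le_card`), so
NO positive is accepted and `Horns.pair_of_blind` applies. These gates are wide for `θ ≳ m^{1/16} log m` (minterms =
matchings of `⌈θ/2⌉` resp. `θ` edges) and outside the diameter-two sub-class (a star has diameter two and rank `2`).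
Formalisation note: apply `card_le_rank_of_det_submatrix_ne_zero` to a `Fin t ⊕ Fin t`-indexed minor with EXPLICIT
arguments (placeholders blow up `whnf`).
-/

set_option linter.dupNamespace false
open Literature.Computability.Complexity Filter Finset
open Summit.PneNP.PneNP.Theorems.CliqueExtLowerBound.WidthThreshold

noncomputable section
namespace Summit.PneNP.PneNP.Theorems.CliqueExtLowerBound.WidthThreshold.CocliqueFree

open Summit.PneNP.PneNP.Theorems.CliqueExtLowerBound.WidthThreshold.NarrowAlgebraicHelpers
  (ceil_rpow_sub_one_pow_lt le_ceil_rpow_pow)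

/-! ## §3 (continued) The Tutte minor -/

section GRank

variable {F : Type*} [Field F] {m n : ℕ}

/-- The `2t × 2t` skew unit `[[0, 1], [-1, 0]]` is invertible over any field. [folklore] -/
theorem det_fromBlocks_skewUnit_ne_zero (t : ℕ) :
    (Matrix.fromBlocks (0 : Matrix (Fin t) (Fin t) F) (1 : Matrix (Fin t) (Fin t) F)
      (-1 : Matrix (Fin t) (Fin t) F) (0 : Matrix (Fin t) (Fin t) F)).det ≠ 0 := by
  have h : Matrix.fromBlocks (0 : Matrix (Fin t) (Fin t) F) (1 : Matrix (Fin t) (Fin t) F)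
      (-1 : Matrix (Fin t) (Fin t) F) (0 : Matrix (Fin t) (Fin t) F) =
      (Matrix.fromBlocks (1 : Matrix (Fin t) (Fin t) F) (0 : Matrix (Fin t) (Fin t) F)
        (0 : Matrix (Fin t) (Fin t) F) (-1 : Matrix (Fin t) (Fin t) F)).submatrix id
        (Equiv.sumComm (Fin t) (Fin t)) := by
    ext (i | i) (j | j) <;> rfl
  rw [h, Matrix.det_permute', Matrix.det_fromBlocks_zero₁₂, Matrix.det_one, one_mul, Matrix.det_neg,
    Matrix.det_one, mul_one]
  refine mul_ne_zero ?_ (pow_ne_zero _ (neg_ne_zero.2 one_ne_zero))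
  rcases Int.units_eq_one_or (Equiv.Perm.sign (Equiv.sumComm (Fin t) (Fin t))) with hs | hs <;>
    simp [hs]

/-- **Tutte minor.** For the skew data `K j = E_{a j, b j} - E_{b j, a j}` (Tutte 1947) and `t`
switched-on wires with pairwise distinct endpoints, the generic rank of `∑_{v_j = 1} X_j K_j` is at
least `2t`: switching on exactly those wires and specialising `X := 1`, the principal minor on the
`2t` endpoints is the skew unit `[[0, 1], [-1, 0]]`. [folklore] -/
theorem tutte_rank_ge {t : ℕ} (a b : Fin n → Fin m) (v : Fin n → Bool) (J : Fin t → Fin n)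
    (hJv : ∀ i, v (J i) = true) (hJa : Function.Injective (a ∘ J))
    (hJb : Function.Injective (b ∘ J)) (hJab : ∀ i i', a (J i) ≠ b (J i')) :
    2 * t ≤ (symbolicMatrix (0 : Matrix (Fin m) (Fin m) F)
      (fun j => Matrix.single (a j) (b j) (1 : F) - Matrix.single (b j) (a j) 1) v).rank := by
  classical
  have hJinj : Function.Injective J := fun i i' h => hJa (by simp [h])
  have haJ : ∀ i i', a (J i) = a (J i') ↔ i = i' := fun i i' =>
    ⟨fun h => hJa h, fun h => h ▸ rfl⟩
  have hbJ : ∀ i i', b (J i) = b (J i') ↔ i = i' := fun i i' =>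
    ⟨fun h => hJb h, fun h => h ▸ rfl⟩
  have hab' : ∀ i i', (a (J i) = b (J i')) ↔ False := fun i i' => ⟨fun h => hJab i i' h, False.elim⟩
  have hba' : ∀ i i', (b (J i) = a (J i')) ↔ False := fun i i' =>
    ⟨fun h => hJab i' i h.symm, False.elim⟩
  set v' : Fin n → Bool := fun j => decide (j ∈ univ.image J) with hv'
  have hle : v' ≤ v := by
    intro j
    by_cases h : j ∈ univ.image J
    · obtain ⟨i, -, rfl⟩ := mem_image.1 h
      rw [hJv i]
      exact le_top
    · have h0 : v' j = false := by rw [hv']; exact decide_eq_false h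
      rw [h0]
      exact Bool.false_le _
  refine le_trans ?_ (symbolicMatrix_rank_mono _ _ hle)
  have hS : (0 : Matrix (Fin m) (Fin m) F) + ∑ j, (if v' j then
      Matrix.single (a j) (b j) (1 : F) - Matrix.single (b j) (a j) 1 else 0) =
      ∑ i, (Matrix.single (a (J i)) (b (J i)) (1 : F) - Matrix.single (b (J i)) (a (J i)) 1) := by
    rw [zero_add, ← Finset.sum_filter]
    have hfilt : (univ.filter fun j => v' j = true) = univ.image J := by
      ext j
      simp [hv']
    rw [hfilt, sum_image fun x _ y _ h => hJinj h]
  have hnum : (∑ i, (Matrix.single (a (J i)) (b (J i)) (1 : F) -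
      Matrix.single (b (J i)) (a (J i)) 1)).submatrix (Sum.elim (a ∘ J) (b ∘ J))
        (Sum.elim (a ∘ J) (b ∘ J)) = Matrix.fromBlocks (0 : Matrix (Fin t) (Fin t) F)
          (1 : Matrix (Fin t) (Fin t) F) (-1 : Matrix (Fin t) (Fin t) F) (0 : Matrix (Fin t) (Fin t) F) := by
    ext (i | i) (i' | i')
    · simp only [Matrix.submatrix_apply, Matrix.sum_apply, Matrix.sub_apply, Sum.elim_inl,
        Function.comp_apply, Matrix.single_apply, haJ, hba', and_false, false_and, if_false, sub_zero,
        Finset.sum_const_zero, Matrix.fromBlocks_apply₁₁, Matrix.zero_apply]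
    · simp only [Matrix.submatrix_apply, Matrix.sum_apply, Matrix.sub_apply, Sum.elim_inl,
        Sum.elim_inr, Function.comp_apply, Matrix.single_apply, haJ, hbJ, hab', hba', and_false,
        if_false, sub_zero, Matrix.fromBlocks_apply₁₂, Matrix.one_apply, ite_and, Finset.sum_ite_eq',
        Finset.mem_univ, if_true]
    · simp only [Matrix.submatrix_apply, Matrix.sum_apply, Matrix.sub_apply, Sum.elim_inl,
        Sum.elim_inr, Function.comp_apply, Matrix.single_apply, haJ, hbJ, hab', hba', and_false,
        if_false, zero_sub, Matrix.fromBlocks_apply₂₁, Matrix.neg_apply, Matrix.one_apply, ite_and,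
        Finset.sum_neg_distrib, Finset.sum_ite_eq', Finset.mem_univ, if_true]
    · simp only [Matrix.submatrix_apply, Matrix.sum_apply, Matrix.sub_apply, Sum.elim_inr,
        Function.comp_apply, Matrix.single_apply, hbJ, hab', and_false, false_and, if_false, sub_zero,
        Finset.sum_const_zero, Matrix.fromBlocks_apply₂₂, Matrix.zero_apply]
  have hdet : ((((0 : Matrix (Fin m) (Fin m) F) + ∑ j, if v' j then
      Matrix.single (a j) (b j) (1 : F) - Matrix.single (b j) (a j) 1 else 0).submatrix
        (Sum.elim (a ∘ J) (b ∘ J)) (Sum.elim (a ∘ J) (b ∘ J)))).det ≠ 0 := by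
    rw [hS, hnum]
    exact det_fromBlocks_skewUnit_ne_zero t
  have h0 : ((symbolicMatrix (0 : Matrix (Fin m) (Fin m) F)
      (fun j => Matrix.single (a j) (b j) (1 : F) - Matrix.single (b j) (a j) 1) v').submatrix
        (Sum.elim (a ∘ J) (b ∘ J)) (Sum.elim (a ∘ J) (b ∘ J))).det ≠ 0 :=
    det_submatrix_symbolicMatrix_ne_zero_of_eval _ _ v' _ _ hdet
  -- (explicit arguments: unifying the `Fin t ⊕ Fin t`-indexed minor through `_`s blows up `whnf`)
  have h := Literature.LinearAlgebra.Matrix.card_le_rank_of_det_submatrix_ne_zero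
    (symbolicMatrix (0 : Matrix (Fin m) (Fin m) F)
      (fun j => Matrix.single (a j) (b j) (1 : F) - Matrix.single (b j) (a j) 1) v')
    (Sum.elim (a ∘ J) (b ∘ J)) (Sum.elim (a ∘ J) (b ∘ J)) h0
  have hcard : Fintype.card (Fin t ⊕ Fin t) = 2 * t := by
    rw [Fintype.card_sum, Fintype.card_fin, two_mul]
  omega

end GRank

/-! ## §4 Matching-rank gates on the edges satisfy the leaf `stub_grankCnf` -/

/-- The slot of `K_m` read by a wire with distinct endpoints. [folklore] -/
theorem mem_edgeSet_of_ne {m : ℕ} {p q : Fin m} (h : p ≠ q) :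
    s(p, q) ∈ (⊤ : SimpleGraph (Fin m)).edgeSet :=
  (SimpleGraph.mem_edgeSet ⊤).2 ((SimpleGraph.top_adj _ _).2 h)

/-- `k = ⌈m^{1/4}⌉₊` leaves room: `2k + (c + 19) ≤ m` for `m ≥ max 17 (3 (c + 21))`. [folklore] -/
theorem two_mul_ceil_add_le {m c : ℕ} (hm17 : 17 ≤ m) (hm3 : 3 * (c + 21) ≤ m) :
    2 * ⌈(m : ℝ) ^ (1 / 4 : ℝ)⌉₊ + (c + 19) ≤ m := by
  set k : ℕ := ⌈(m : ℝ) ^ (1 / 4 : ℝ)⌉₊ with hkdef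
  have hk4 : m ≤ k ^ 4 := le_ceil_rpow_pow m 4 (e := 1 / 4) (by norm_num)
  have hk1 : (k - 1) ^ 4 < m := ceil_rpow_sub_one_pow_lt (by omega) 4 (e := 1 / 4) (by norm_num)
  have hk3 : 3 ≤ k := by
    by_contra hlt
    have : k ^ 4 ≤ 2 ^ 4 := Nat.pow_le_pow_left (by omega) 4
    omega
  have hkk : k * k ≤ m := by
    have h2 : k ≤ (k - 1) * (k - 1) :=
      calc k ≤ 2 * (k - 1) := by omega
        _ ≤ (k - 1) * (k - 1) := Nat.mul_le_mul_right _ (by omega)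
    calc k * k ≤ ((k - 1) * (k - 1)) * ((k - 1) * (k - 1)) := Nat.mul_le_mul h2 h2
      _ = (k - 1) ^ 4 := by ring
      _ ≤ m := hk1.le
  nlinarith

open Classical in
/-- **Assembly: a wire gate whose acceptance is a rank condition `θ ≤ ρ` that is witnessed by matchings
and supported on the touched vertices satisfies the leaf.** Wires `j` read the slots `{a j, b j}` of
`K_m` (every slot read by some wire), the children are the raw single-slot CNFs `{{slot j}}`, and the
gate accepts `v` iff `θ ≤ ρ v`, where (i) `t` switched-on wires with pairwise distinct endpoints force
`t ≤ ρ v` and (ii) `ρ v ≤ #Q` whenever every switched-on wire has both endpoints in `Q`. Then for every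
`c`, eventually in `m`, for every threshold `θ` and locality `(r, s)` the pair demanded by
`stub_grankCnf` exists: if `2θ + (c+19) ≤ m + 2` the gate accepts every graph without a coclique on
`c + 19` vertices (`exists_wireMatching`, (i)) and `pair_of_acceptsCocliqueFree` applies; otherwise
`θ > ⌈m^{1/4}⌉₊` (`two_mul_ceil_add_le`) and by (ii) no bare `⌈m^{1/4}⌉₊`-clique is accepted, so the
gate is blind on the positives (`Horns.pair_of_blind`). [folklore] -/
theorem wireGate_grankCnf_of_matching (c : ℕ) : ∀ᶠ m : ℕ in atTop, ∀ (n : ℕ)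
    (a b : Fin n → Fin m) (hab : ∀ j, a j ≠ b j),
    (∀ e : EV m, ∃ j, (e : Sym2 (Fin m)) = s(a j, b j)) → ∀ ρ : (Fin n → Bool) → ℕ,
    (∀ (t : ℕ) (v : Fin n → Bool) (J : Fin t → Fin n), (∀ i, v (J i) = true) →
      Function.Injective (a ∘ J) → Function.Injective (b ∘ J) →
      (∀ i i', a (J i) ≠ b (J i')) → t ≤ ρ v) →
    (∀ (v : Fin n → Bool) (Q : Finset (Fin m)), (∀ j, v j = true → a j ∈ Q ∧ b j ∈ Q) →
      ρ v ≤ #Q) →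
    ∀ θ r s : ℕ,
    ∃ dnf cnf : Finset (Finset (EV m)), (∀ R ∈ dnf, #R ≤ r - 1) ∧ (∀ S ∈ cnf, #S ≤ s - 1) ∧
      (∀ x, EvalDNF dnf x → EvalCNF cnf x) ∧
      (#((posGraphs m ⌈(m : ℝ) ^ (1 / 4 : ℝ)⌉₊).filter fun x =>
          decide (θ ≤ ρ fun j => decide (EvalCNF
            ({{⟨s(a j, b j), mem_edgeSet_of_ne (hab j)⟩}} : Finset (Finset (EV m))) x)) = true ∧
          ¬ EvalDNF dnf x) : ℝ) ≤
        (1 / (8 * (m : ℝ) ^ (c + 1))) * #(posGraphs m ⌈(m : ℝ) ^ (1 / 4 : ℝ)⌉₊) ∧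
      (#((((powersetCard (Fintype.card (EV m) / ⌊(m : ℝ) ^ (1 / 8 : ℝ)⌋₊)
        (univ : Finset (EV m))).image (fun M => fun e => decide (e ∉ M)))).filter
          fun x => EvalCNF cnf x ∧
            decide (θ ≤ ρ fun j => decide (EvalCNF
              ({{⟨s(a j, b j), mem_edgeSet_of_ne (hab j)⟩}} : Finset (Finset (EV m))) x)) =
              false) : ℝ) ≤
        (1 / (8 * (m : ℝ) ^ (c + 1))) *
          #(((powersetCard (Fintype.card (EV m) / ⌊(m : ℝ) ^ (1 / 8 : ℝ)⌋₊)
            (univ : Finset (EV m))).image (fun M => fun e => decide (e ∉ M)))) := by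
  filter_upwards [pair_of_acceptsCocliqueFree c (c + 19) le_rfl,
    eventually_ge_atTop (max 17 (3 * (c + 21)))] with m hpair hm n a b hab hsurj ρ hlow hupp θ r s
  have h2k : 2 * ⌈(m : ℝ) ^ (1 / 4 : ℝ)⌉₊ + (c + 19) ≤ m :=
    two_mul_ceil_add_le (le_of_max_le_left hm) (le_of_max_le_right hm)
  set k : ℕ := ⌈(m : ℝ) ^ (1 / 4 : ℝ)⌉₊ with hkdef
  set g : (EV m → Bool) → Bool := fun x => decide (θ ≤ ρ fun j => decide (EvalCNF
      ({{⟨s(a j, b j), mem_edgeSet_of_ne (hab j)⟩}} : Finset (Finset (EV m))) x)) with hgdef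
  by_cases hθ : 2 * θ + (c + 19) ≤ m + 2
  · -- the gate accepts every graph without a coclique on `c + 19` vertices
    refine hpair g (fun y hy => ?_) _ r s
    rw [hgdef, decide_eq_true_iff]
    set v : Fin n → Bool := fun j => decide (EvalCNF
      ({{⟨s(a j, b j), mem_edgeSet_of_ne (hab j)⟩}} : Finset (Finset (EV m))) y) with hvdef
    have hv : ∀ W : Finset (Fin m), #W = c + 19 → ∃ j, a j ∈ W ∧ b j ∈ W ∧ v j = true := by
      intro W hW
      obtain ⟨e, heW, hye⟩ := hy W hW
      obtain ⟨j, hj⟩ := hsurj e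
      have hee : (⟨s(a j, b j), mem_edgeSet_of_ne (hab j)⟩ : EV m) = e := Subtype.ext hj.symm
      refine ⟨j, heW _ (by rw [hj]; exact Sym2.mem_mk_left _ _),
        heW _ (by rw [hj]; exact Sym2.mem_mk_right _ _), ?_⟩
      simp only [hvdef, evalCNF_singleton_singleton, hee, hye, decide_true]
    obtain ⟨J, hJv, hJa, hJb, hJab⟩ := exists_wireMatching a b hab v hv θ hθ
    exact hlow θ v J hJv hJa hJb hJab
  · -- no bare `k`-clique is accepted: blind on the positives
    have hθk : k < θ := by omega
    have hP0 : (posGraphs m k).filter (fun x => g x = true) = ∅ := by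
      refine filter_eq_empty_iff.2 fun x hx hgx => ?_
      rw [hgdef, decide_eq_true_iff] at hgx
      obtain ⟨Q, hQ, rfl⟩ := mem_image.1 hx
      rw [mem_powersetCard] at hQ
      have hρ : ρ (fun j => decide (EvalCNF
          ({{⟨s(a j, b j), mem_edgeSet_of_ne (hab j)⟩}} : Finset (Finset (EV m))) (cliqueVec Q))) ≤
          #Q := hupp _ Q fun j hj => by
        rw [decide_eq_true_iff, evalCNF_singleton_singleton] at hj
        simp only [cliqueVec, decide_eq_true_eq] at hj
        exact ⟨hj _ (Sym2.mem_mk_left _ _), hj _ (Sym2.mem_mk_right _ _)⟩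
      rw [hQ.2] at hρ
      omega
    refine Horns.pair_of_blind g _ _ (by positivity) r s (Or.inl ?_)
    rw [hP0, card_empty, Nat.cast_zero]
    positivity

open Classical in
/-- **The Tutte matching gates are GRANK gates** on `m` points (dimension `m ≤ m^c` for `c ≥ 1`): data
`F` any field, `d = m`, `K₀ = 0`, `K_j = E_{a j, b j} - E_{b j, a j}`, any threshold `θ`
(Tutte 1947; for `θ = m` and one wire per edge this is "the on-edges contain a perfect matching").
[folklore] -/
theorem tutteGate_isGRankGate {m n : ℕ} (F : Type) [Field F] (a b : Fin n → Fin m) (θ : ℕ) :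
    IsGRankGate m ⟨n, fun v => decide (θ ≤ (symbolicMatrix (0 : Matrix (Fin m) (Fin m) F)
      (fun j => Matrix.single (a j) (b j) (1 : F) - Matrix.single (b j) (a j) 1) v).rank)⟩ :=
  ⟨F, inferInstance, m, θ, le_rfl, 0, _, fun _ => decide_eq_true_iff⟩

open Classical in
/-- **The Edmonds (bipartite-orientation) matching gates are GRANK gates** on `m` points: `K₀ = 0`,
rank-ONE data `K_j = E_{a j, b j}` (a transversal-matroid / bipartite-matching gate: `θ ≤ rank` iff the
switched-on cells `(a j, b j)` contain `θ` cells in distinct rows and distinct columns, Edmonds 1967),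
any threshold `θ`. [folklore] -/
theorem edmondsGate_isGRankGate {m n : ℕ} (F : Type) [Field F] (a b : Fin n → Fin m) (θ : ℕ) :
    IsGRankGate m ⟨n, fun v => decide (θ ≤ (symbolicMatrix (0 : Matrix (Fin m) (Fin m) F)
      (fun j => Matrix.single (a j) (b j) (1 : F)) v).rank)⟩ :=
  ⟨F, inferInstance, m, θ, le_rfl, 0, _, fun _ => decide_eq_true_iff⟩

open Classical in
/-- **The Tutte matching gates satisfy the leaf `stub_grankCnf`** — over ANY field, for EVERY threshold
`θ`, every wiring `j ↦ {a j, b j}` onto the edge slots (repetitions allowed) and raw single-slot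
children, for every `c` and all large `m`: the legal local pair with both errors `≤ 1/(8m^{c+1})`
exists. On a graph whose `t`-matchings are switched on the generic rank is `≥ 2t` (`tutte_rank_ge`), on
a bare clique `Q` it is `≤ #Q` (`rank_symbolicMatrix_le_card`); so `wireGate_grankCnf_of_matching`
applies: for `2θ + c + 19 ≤ m + 2` the gate accepts every coclique-free graph and is NEG-BLIND at the
sharp threshold, otherwise it rejects every positive. (For `θ > ⌊m^{1/16}⌋₊ (log₂ ⌊m^{1/16}⌋₊ + 1)` these
gates are WIDE — every minterm is a matching of `⌈θ/2⌉` edges — and they are NOT in the diameter-two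
sub-class: a star has diameter two and rank `2`.) [folklore] -/
theorem tutteGate_grankCnf : ∀ c : ℕ, ∀ᶠ m : ℕ in atTop, ∀ (F : Type) [Field F] (n : ℕ)
    (a b : Fin n → Fin m) (hab : ∀ j, a j ≠ b j),
    (∀ e : EV m, ∃ j, (e : Sym2 (Fin m)) = s(a j, b j)) → ∀ θ r s : ℕ,
    ∃ dnf cnf : Finset (Finset (EV m)), (∀ R ∈ dnf, #R ≤ r - 1) ∧ (∀ S ∈ cnf, #S ≤ s - 1) ∧
      (∀ x, EvalDNF dnf x → EvalCNF cnf x) ∧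
      (#((posGraphs m ⌈(m : ℝ) ^ (1 / 4 : ℝ)⌉₊).filter fun x =>
          decide (θ ≤ (symbolicMatrix (0 : Matrix (Fin m) (Fin m) F)
            (fun j => Matrix.single (a j) (b j) (1 : F) - Matrix.single (b j) (a j) 1)
            fun j => decide (EvalCNF
              ({{⟨s(a j, b j), mem_edgeSet_of_ne (hab j)⟩}} : Finset (Finset (EV m))) x)).rank) =
            true ∧ ¬ EvalDNF dnf x) : ℝ) ≤
        (1 / (8 * (m : ℝ) ^ (c + 1))) * #(posGraphs m ⌈(m : ℝ) ^ (1 / 4 : ℝ)⌉₊) ∧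
      (#((((powersetCard (Fintype.card (EV m) / ⌊(m : ℝ) ^ (1 / 8 : ℝ)⌋₊)
        (univ : Finset (EV m))).image (fun M => fun e => decide (e ∉ M)))).filter
          fun x => EvalCNF cnf x ∧
            decide (θ ≤ (symbolicMatrix (0 : Matrix (Fin m) (Fin m) F)
              (fun j => Matrix.single (a j) (b j) (1 : F) - Matrix.single (b j) (a j) 1)
              fun j => decide (EvalCNF
                ({{⟨s(a j, b j), mem_edgeSet_of_ne (hab j)⟩}} : Finset (Finset (EV m))) x)).rank) =
              false) : ℝ) ≤
        (1 / (8 * (m : ℝ) ^ (c + 1))) *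
          #(((powersetCard (Fintype.card (EV m) / ⌊(m : ℝ) ^ (1 / 8 : ℝ)⌋₊)
            (univ : Finset (EV m))).image (fun M => fun e => decide (e ∉ M)))) := by
  intro c
  filter_upwards [wireGate_grankCnf_of_matching c] with m hm F _ n a b hab hsurj θ r s
  refine hm n a b hab hsurj (fun v => (symbolicMatrix (0 : Matrix (Fin m) (Fin m) F)
    (fun j => Matrix.single (a j) (b j) (1 : F) - Matrix.single (b j) (a j) 1) v).rank)
    (fun t v J hJv hJa hJb hJab => ?_) (fun v Q hQ => ?_) θ r s
  · exact le_trans (by omega) (tutte_rank_ge a b v J hJv hJa hJb hJab)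
  · refine rank_symbolicMatrix_le_card _ v Q fun j hj p q hp => ?_
    obtain ⟨ha, hb⟩ := hQ j hj
    have hpa : a j ≠ p := fun h => hp (h ▸ ha)
    have hpb : b j ≠ p := fun h => hp (h ▸ hb)
    simp [Matrix.sub_apply, Matrix.single_apply_of_row_ne hpa, Matrix.single_apply_of_row_ne hpb]

open Classical in
/-- **The Edmonds matching gates satisfy the leaf `stub_grankCnf`** (the rank-one / transversal-matroid
class `K₀ = 0`, `K_j = E_{a j, b j}`): same statement and proof as `tutteGate_grankCnf`, with
`edmonds_rank_ge` (rank `≥ t` on a `t`-matching). [folklore] -/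
theorem edmondsGate_grankCnf : ∀ c : ℕ, ∀ᶠ m : ℕ in atTop, ∀ (F : Type) [Field F] (n : ℕ)
    (a b : Fin n → Fin m) (hab : ∀ j, a j ≠ b j),
    (∀ e : EV m, ∃ j, (e : Sym2 (Fin m)) = s(a j, b j)) → ∀ θ r s : ℕ,
    ∃ dnf cnf : Finset (Finset (EV m)), (∀ R ∈ dnf, #R ≤ r - 1) ∧ (∀ S ∈ cnf, #S ≤ s - 1) ∧
      (∀ x, EvalDNF dnf x → EvalCNF cnf x) ∧
      (#((posGraphs m ⌈(m : ℝ) ^ (1 / 4 : ℝ)⌉₊).filter fun x =>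
          decide (θ ≤ (symbolicMatrix (0 : Matrix (Fin m) (Fin m) F)
            (fun j => Matrix.single (a j) (b j) (1 : F))
            fun j => decide (EvalCNF
              ({{⟨s(a j, b j), mem_edgeSet_of_ne (hab j)⟩}} : Finset (Finset (EV m))) x)).rank) =
            true ∧ ¬ EvalDNF dnf x) : ℝ) ≤
        (1 / (8 * (m : ℝ) ^ (c + 1))) * #(posGraphs m ⌈(m : ℝ) ^ (1 / 4 : ℝ)⌉₊) ∧
      (#((((powersetCard (Fintype.card (EV m) / ⌊(m : ℝ) ^ (1 / 8 : ℝ)⌋₊)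
        (univ : Finset (EV m))).image (fun M => fun e => decide (e ∉ M)))).filter
          fun x => EvalCNF cnf x ∧
            decide (θ ≤ (symbolicMatrix (0 : Matrix (Fin m) (Fin m) F)
              (fun j => Matrix.single (a j) (b j) (1 : F))
              fun j => decide (EvalCNF
                ({{⟨s(a j, b j), mem_edgeSet_of_ne (hab j)⟩}} : Finset (Finset (EV m))) x)).rank) =
              false) : ℝ) ≤
        (1 / (8 * (m : ℝ) ^ (c + 1))) *
          #(((powersetCard (Fintype.card (EV m) / ⌊(m : ℝ) ^ (1 / 8 : ℝ)⌋₊)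
            (univ : Finset (EV m))).image (fun M => fun e => decide (e ∉ M)))) := by
  intro c
  filter_upwards [wireGate_grankCnf_of_matching c] with m hm F _ n a b hab hsurj θ r s
  refine hm n a b hab hsurj (fun v => (symbolicMatrix (0 : Matrix (Fin m) (Fin m) F)
    (fun j => Matrix.single (a j) (b j) (1 : F)) v).rank)
    (fun t v J hJv hJa hJb _ => edmonds_rank_ge a b v J hJv hJa hJb) (fun v Q hQ => ?_) θ r s
  refine rank_symbolicMatrix_le_card _ v Q fun j hj p q hp => ?_
  have hpa : a j ≠ p := fun h => hp (h ▸ (hQ j hj).1)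
  exact Matrix.single_apply_of_row_ne hpa _ _ _

end Summit.PneNP.PneNP.Theorems.CliqueExtLowerBound.WidthThreshold.CocliqueFree

end
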